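import Summits.QuantumFields.YangMills.Theorems.BalabanLadderNTBoundaryLawCentred
import HarnessLib

/-!
# Crux `NT` (stmt-QuantumFields-19353), stub `stub_cfpw : CFPW`: the boundary laws in REFERENCE-FREE OSCILLATION form, on sparse radii

Helper file (`--supports stmt-QuantumFields-19353`) of the fleet lead prover of crux `NT` (unit `ym-spine-19353-p1`,
g3); an unconditional reduction on the ENGINE side of the registered stub `stub_cfpw : CFPW` (skeleton v3
«weak-package», 374f16092bb0c203, conjunct `FBL G r a`), sharpening `fbl_of_centred` / `fbl6_of_centred` of the sibling file
`…BoundaryLawCentred` (g2: the boundary law is needed only at the CENTRAL SITE of CENTRED femto cubes `[-R, R]⁴`).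

The registered femto boundary law `FBL G r a` (`Theorems/LangevinControlUVOSLegsFromFemtoAndGapDefs.lean`) asks for a
REFERENCE VALUE `p β` with `|kerE − p β| ≤ C₁/d⁴`.  An engine comparing two boundary conditions never produces such a `p`;
it produces an OSCILLATION bound `|kerE_{Q,η} F − kerE_{Q,η'} F| ≤ ε` (Dobrushin-type influence of the exterior).  This file
shows that is enough, and that it is enough on the engine's own (geometric) sequence of cube sizes:

* `abs_kerE_sub_kerE_le_of_subset` — the exterior-to-exterior oscillation of a kernel mean is ANTITONE under nesting of
  cubes (DLR consistency: the big-cube mean is an average of small-cube means over induced exteriors);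
* `fbl_of_oscillation` — for a unit map with `0 < a`, `FBL G r a` follows from: for `β ≥ β₁`, every radius `R ≥ D` with
  `(2R+1) · a β ≤ ℓ₁` and every PAIR of exteriors `η, η'`,
  `|kerE_{[-R,R]⁴,η}(dens 0) − kerE_{[-R,R]⁴,η'}(dens 0)| ≤ C₁/(R+1)⁴` (no reference value: `p β` is manufactured as the
  central kernel mean of ONE large cube `[-N(β), N(β)]⁴`, `N(β) = ⌈ℓ₁ / a β⌉₊ ≥` every admissible radius, with the unit
  exterior, by `abs_kerE_sub_le_of_subset`);
* `fbl6_of_oscillation` — the same for the plane-resolved law `FBL6 G r a` and the ONE field `plane G r (0,1) 0`;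
* `fbl_of_oscillation_cover`, `fbl6_of_oscillation_cover` — it suffices to have the oscillation bound for radii in ANY set
  `S ⊆ ℕ` that covers all radii up to a factor `θ` (`∀ R ≥ D, ∃ R₀ ∈ S, R₀ ≤ R, R+1 ≤ θ (R₀+1)`), at the price
  `C₁ ↦ θ⁴ C₁` (antitonicity);
* `fbl_of_oscillation_seq` — in particular along any unbounded sequence of radii `R_k` with `R_{k+1} + 1 ≤ θ (R_k + 1)`
  (e.g. the side lengths `L^k M` of a multiscale expansion), constant `θ⁴ C₁`.

So the engine statement E1 of `Cruxes/NT/Lines/engine-target.md` becomes: **the exterior-to-exterior oscillation of the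
central kernel mean of the action density (resp. of one plaquette field) on the centred femto cubes of the engine's own
radii decays like `(R+1)⁻⁴`, uniformly in `β ≥ β₁`.**  Refs: Georgii 2011 Def. 1.23 (iii) (consistency), §8.1
(influence of boundary conditions); Bałaban 1989 (CMP 122) p. 356 for the announced observable-level analysis.
-/

set_option autoImplicit false

noncomputable section

open MeasureTheory Filter Topology
open Literature.MathematicalPhysics.QuantumFieldTheory Literature.MathematicalPhysics.QuantumLattice
open Literature.Probability.LatticeModels
open Summit.QuantumFields.YangMills.Cruxes.OSLegsFromFemtoAndGap.DlrCollarTransfer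
open Summit.QuantumFields.YangMills.Cruxes.OSLegsFromFemtoAndGap.DlrCollarTransfer.StubLower (exists_abs_dens_le)

namespace Summit.QuantumFields.YangMills.Cruxes.NT.BoundaryLaw

/-! ## §1 Oscillation over exteriors is antitone under nesting -/

section Kernel

variable (G : Type) [Group G] [TopologicalSpace G] [IsTopologicalGroup G] [CompactSpace G]
  [MeasurableSpace G] [BorelSpace G] (r : LatticeRep G)

/-- **A big-cube kernel mean is within the oscillation of the small-cube kernel means.**  For nested cubes `Q' ⊆ Q`,
a bounded continuous observable `F` whose `Q'`-kernel means oscillate by at most `ε` over the exteriors, every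
`Q`-kernel mean of `F` is within `ε` of every `Q'`-kernel mean of `F` (consistency: the `Q`-mean is an average of
`Q'`-means). [folklore] -/
theorem abs_kerE_sub_kerE_inner_le (β : ℝ) {c c' : Fin 4 → ℤ} {b b' : ℕ} (hsub : cubeEdges c' b' ⊆ cubeEdges c b)
    {F : LGConfig 4 G → ℝ} (hFc : Continuous F) {M : ℝ} (hM : ∀ U, |F U| ≤ M) {ε : ℝ}
    (h : ∀ ζ ζ' : LGConfig 4 G, |kerE G r β c' b' ζ F - kerE G r β c' b' ζ' F| ≤ ε) (η ζ : LGConfig 4 G) :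
    |kerE G r β c b η F - kerE G r β c' b' ζ F| ≤ ε :=
  abs_kerE_sub_le_of_subset G r β hsub η hFc hM fun ζ' => h ζ' ζ

/-- **Oscillation is antitone under nesting.**  For nested cubes `Q' ⊆ Q` and a bounded continuous observable `F`: if
the `Q'`-kernel means of `F` oscillate by at most `ε` over all exteriors, so do the `Q`-kernel means (two averaging
steps). [folklore] -/
theorem abs_kerE_sub_kerE_le_of_subset (β : ℝ) {c c' : Fin 4 → ℤ} {b b' : ℕ} (hsub : cubeEdges c' b' ⊆ cubeEdges c b)
    {F : LGConfig 4 G → ℝ} (hFc : Continuous F) {M : ℝ} (hM : ∀ U, |F U| ≤ M) {ε : ℝ}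
    (h : ∀ ζ ζ' : LGConfig 4 G, |kerE G r β c' b' ζ F - kerE G r β c' b' ζ' F| ≤ ε) (η η' : LGConfig 4 G) :
    |kerE G r β c b η F - kerE G r β c b η' F| ≤ ε :=
  abs_kerE_sub_le_of_subset G r β hsub η hFc hM fun ζ => by
    rw [abs_sub_comm]; exact abs_kerE_sub_kerE_inner_le G r β hsub hFc hM h η' ζ

/-! ## §2 Centred cubes: nesting and admissibility -/

/-- Centred cubes are nested: `[-R, R]⁴ ⊆ [-N, N]⁴` (interior links) for `R ≤ N`. [folklore] -/
theorem cubeEdges_centred_subset {R N : ℕ} (h : R ≤ N) :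
    cubeEdges (fun _ => -(R : ℤ)) (2 * R + 1) ⊆ cubeEdges (fun _ => -(N : ℤ)) (2 * N + 1) :=
  cubeEdges_subset (cubeSites_subset fun _ => ⟨by omega, by push_cast; omega⟩)

/-- An admissible radius (`(2R+1) · a β ≤ ℓ₁`, `0 < a β`) is at most `⌈ℓ₁ / a β⌉₊`. [folklore] -/
theorem le_ceil_of_admissible {a ℓ₁ : ℝ} (ha : 0 < a) {R : ℕ} (hR : ((2 * R + 1 : ℕ) : ℝ) * a ≤ ℓ₁) :
    R ≤ ⌈ℓ₁ / a⌉₊ := by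
  have h1 : (R : ℝ) * a ≤ ℓ₁ := by
    have h2 : (R : ℝ) ≤ ((2 * R + 1 : ℕ) : ℝ) := by push_cast; linarith
    exact (mul_le_mul_of_nonneg_right h2 ha.le).trans hR
  have h3 : (R : ℝ) ≤ ℓ₁ / a := by rw [le_div_iff₀ ha]; exact h1
  exact_mod_cast h3.trans (Nat.le_ceil _)

/-- A smaller radius is admissible if a larger one is (`0 < a β`). [folklore] -/
theorem admissible_of_le {a ℓ₁ : ℝ} (ha : 0 < a) {R₀ R : ℕ} (h : R₀ ≤ R) (hR : ((2 * R + 1 : ℕ) : ℝ) * a ≤ ℓ₁) :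
    ((2 * R₀ + 1 : ℕ) : ℝ) * a ≤ ℓ₁ := by
  have h2 : ((2 * R₀ + 1 : ℕ) : ℝ) ≤ ((2 * R + 1 : ℕ) : ℝ) := by exact_mod_cast (by omega : 2 * R₀ + 1 ≤ 2 * R + 1)
  exact (mul_le_mul_of_nonneg_right h2 ha.le).trans hR

/-! ## §3 `FBL` and `FBL6` from reference-free oscillation bounds -/

/-- **`FBL` from an oscillation bound (no reference value).**  For a unit map with `0 < a β`: if for some `D` and
witnesses `C₁, β₁, ℓ₁ > 0` the kernel means of the action density AT THE ORIGIN of the femto cubes `[-R, R]⁴` (`R ≥ D`,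
`(2R+1) · a β ≤ ℓ₁`, `β ≥ β₁`) under any TWO exteriors differ by at most `C₁/(R+1)⁴`, then the registered femto boundary
law `FBL G r a` holds.  The reference value is the central kernel mean of the cube `[-N, N]⁴`, `N = ⌈ℓ₁ / a β⌉₊`, with
the unit exterior: every admissible cube is nested in it, and the big-cube mean is an average of small-cube means
(`abs_kerE_sub_kerE_inner_le`); then `fbl_of_centred D`. [folklore] -/
theorem fbl_of_oscillation (a : ℝ → ℝ) (ha : ∀ β, 0 < a β) (D : ℕ)
    (h : ∃ (C₁ β₁ ℓ₁ : ℝ), 0 < ℓ₁ ∧ ∀ β : ℝ, β₁ ≤ β → ∀ R : ℕ, D ≤ R →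
      ((2 * R + 1 : ℕ) : ℝ) * a β ≤ ℓ₁ → ∀ η η' : LGConfig 4 G,
        |kerE G r β (fun _ => -(R : ℤ)) (2 * R + 1) η (dens G r 0) -
          kerE G r β (fun _ => -(R : ℤ)) (2 * R + 1) η' (dens G r 0)| ≤ C₁ / ((R : ℝ) + 1) ^ 4) :
    FBL G r a := by
  obtain ⟨C₁, β₁, ℓ₁, hℓ₁, H⟩ := h
  obtain ⟨M, -, hM⟩ := exists_abs_dens_le G r
  -- the reference value: central kernel mean of the largest cube, unit exterior
  let N : ℝ → ℕ := fun β => ⌈ℓ₁ / a β⌉₊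
  let p : ℝ → ℝ := fun β =>
    kerE G r β (fun _ => -(N β : ℤ)) (2 * N β + 1) (fun _ => 1) (dens G r 0)
  refine fbl_of_centred G r a D ⟨C₁, β₁, ℓ₁, p, hℓ₁, fun β hβ R hDR hRa η => ?_⟩
  have hRN : R ≤ N β := le_ceil_of_admissible (ha β) hRa
  have key := abs_kerE_sub_kerE_inner_le G r β (cubeEdges_centred_subset hRN) (continuous_dens r 0) (hM 0)
    (fun ζ ζ' => H β hβ R hDR hRa ζ ζ') (fun _ => 1) η
  rw [abs_sub_comm] at key
  exact key

/-- **`FBL6` from an oscillation bound (no reference value), one orientation.**  The plane-resolved boundary law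
`FBL6 G r a` follows from the same oscillation statement for the ONE single-plane field `plane G r (0, 1) 0` at the
origin of the centred femto cubes (then `fbl6_of_centred D`: translations and a coordinate permutation give every cube,
site and orientation). [folklore] -/
theorem fbl6_of_oscillation (a : ℝ → ℝ) (ha : ∀ β, 0 < a β) (D : ℕ)
    (h : ∃ (C₁ β₁ ℓ₁ : ℝ), 0 < ℓ₁ ∧ ∀ β : ℝ, β₁ ≤ β → ∀ R : ℕ, D ≤ R →
      ((2 * R + 1 : ℕ) : ℝ) * a β ≤ ℓ₁ → ∀ η η' : LGConfig 4 G,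
        |kerE G r β (fun _ => -(R : ℤ)) (2 * R + 1) η (plane G r (0, 1) 0) -
          kerE G r β (fun _ => -(R : ℤ)) (2 * R + 1) η' (plane G r (0, 1) 0)| ≤ C₁ / ((R : ℝ) + 1) ^ 4) :
    FBL6 G r a := by
  obtain ⟨C₁, β₁, ℓ₁, hℓ₁, H⟩ := h
  obtain ⟨M, hM⟩ := exists_abs_plane_le (G := G) r
  let N : ℝ → ℕ := fun β => ⌈ℓ₁ / a β⌉₊
  let p : ℝ → ℝ := fun β =>
    kerE G r β (fun _ => -(N β : ℤ)) (2 * N β + 1) (fun _ => 1) (plane G r (0, 1) 0)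
  refine fbl6_of_centred G r a D ⟨C₁, β₁, ℓ₁, p, hℓ₁, fun β hβ R hDR hRa η => ?_⟩
  have hRN : R ≤ N β := le_ceil_of_admissible (ha β) hRa
  have key := abs_kerE_sub_kerE_inner_le G r β (cubeEdges_centred_subset hRN) (continuous_plane r (0, 1) 0)
    (hM (0, 1) 0) (fun ζ ζ' => H β hβ R hDR hRa ζ ζ') (fun _ => 1) η
  rw [abs_sub_comm] at key
  exact key

/-! ## §4 Sparse radii: a covering set of cube sizes suffices -/

/-- Transport of an oscillation bound from a covering radius: if `R₀ ≤ R`, `R + 1 ≤ θ (R₀ + 1)` and the oscillation at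
radius `R₀` is at most `C₁/(R₀+1)⁴`, then the oscillation at radius `R` is at most `θ⁴ C₁/(R+1)⁴` (antitonicity +
arithmetic). [folklore] -/
theorem osc_le_of_cover (β : ℝ) {F : LGConfig 4 G → ℝ} (hFc : Continuous F) {M : ℝ} (hM : ∀ U, |F U| ≤ M)
    {C₁ θ : ℝ} {R₀ R : ℕ} (hle : R₀ ≤ R) (hθ : (R : ℝ) + 1 ≤ θ * ((R₀ : ℝ) + 1))
    (h : ∀ ζ ζ' : LGConfig 4 G, |kerE G r β (fun _ => -(R₀ : ℤ)) (2 * R₀ + 1) ζ F -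
      kerE G r β (fun _ => -(R₀ : ℤ)) (2 * R₀ + 1) ζ' F| ≤ C₁ / ((R₀ : ℝ) + 1) ^ 4) (η η' : LGConfig 4 G) :
    |kerE G r β (fun _ => -(R : ℤ)) (2 * R + 1) η F - kerE G r β (fun _ => -(R : ℤ)) (2 * R + 1) η' F| ≤
      θ ^ 4 * C₁ / ((R : ℝ) + 1) ^ 4 := by
  have hC₁ : 0 ≤ C₁ / ((R₀ : ℝ) + 1) ^ 4 := (abs_nonneg _).trans (h η η)
  have hC₁' : 0 ≤ C₁ := by
    by_contra hneg
    push Not at hneg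
    have : C₁ / ((R₀ : ℝ) + 1) ^ 4 < 0 := div_neg_of_neg_of_pos hneg (by positivity)
    linarith
  have hθ0 : 0 < θ := by
    by_contra hneg
    push Not at hneg
    have : θ * ((R₀ : ℝ) + 1) ≤ 0 := mul_nonpos_of_nonpos_of_nonneg hneg (by positivity)
    have : (0 : ℝ) ≤ R := by positivity
    linarith
  have hosc := abs_kerE_sub_kerE_le_of_subset G r β (cubeEdges_centred_subset hle) hFc hM h η η'
  refine hosc.trans ?_
  -- `C₁/(R₀+1)⁴ ≤ θ⁴ C₁/(R+1)⁴` since `(R+1)⁴ ≤ θ⁴ (R₀+1)⁴`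
  have hpow : ((R : ℝ) + 1) ^ 4 ≤ θ ^ 4 * ((R₀ : ℝ) + 1) ^ 4 := by
    rw [← mul_pow]; exact pow_le_pow_left₀ (by positivity) hθ 4
  rw [div_le_div_iff₀ (by positivity) (by positivity)]
  calc C₁ * ((R : ℝ) + 1) ^ 4 ≤ C₁ * (θ ^ 4 * ((R₀ : ℝ) + 1) ^ 4) := mul_le_mul_of_nonneg_left hpow hC₁'
    _ = θ ^ 4 * C₁ * ((R₀ : ℝ) + 1) ^ 4 := by ring

/-- **`FBL` from oscillation bounds on a covering set of radii.**  Let `S ⊆ ℕ` cover all radii `R ≥ D` up to a factor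
`θ` (`∃ R₀ ∈ S, R₀ ≤ R, R+1 ≤ θ (R₀+1)`).  If the exterior-to-exterior oscillation of the central kernel mean of the
action density on the femto cubes `[-R₀, R₀]⁴`, `R₀ ∈ S`, is at most `C₁/(R₀+1)⁴` (`β ≥ β₁`, `(2R₀+1) · a β ≤ ℓ₁`), then
`FBL G r a` (constant `θ⁴ C₁`; `0 < a`). [folklore] -/
theorem fbl_of_oscillation_cover (a : ℝ → ℝ) (ha : ∀ β, 0 < a β) (S : Set ℕ) (θ : ℝ) (D : ℕ)
    (hcover : ∀ R : ℕ, D ≤ R → ∃ R₀ ∈ S, R₀ ≤ R ∧ (R : ℝ) + 1 ≤ θ * ((R₀ : ℝ) + 1))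
    (h : ∃ (C₁ β₁ ℓ₁ : ℝ), 0 < ℓ₁ ∧ ∀ β : ℝ, β₁ ≤ β → ∀ R₀ ∈ S,
      ((2 * R₀ + 1 : ℕ) : ℝ) * a β ≤ ℓ₁ → ∀ η η' : LGConfig 4 G,
        |kerE G r β (fun _ => -(R₀ : ℤ)) (2 * R₀ + 1) η (dens G r 0) -
          kerE G r β (fun _ => -(R₀ : ℤ)) (2 * R₀ + 1) η' (dens G r 0)| ≤ C₁ / ((R₀ : ℝ) + 1) ^ 4) :
    FBL G r a := by
  obtain ⟨C₁, β₁, ℓ₁, hℓ₁, H⟩ := h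
  obtain ⟨M, -, hM⟩ := exists_abs_dens_le G r
  refine fbl_of_oscillation G r a ha D ⟨θ ^ 4 * C₁, β₁, ℓ₁, hℓ₁, fun β hβ R hDR hRa η η' => ?_⟩
  obtain ⟨R₀, hR₀S, hle, hθ⟩ := hcover R hDR
  exact osc_le_of_cover G r β (continuous_dens r 0) (hM 0) hle hθ
    (H β hβ R₀ hR₀S (admissible_of_le (ha β) hle hRa)) η η'

/-- **`FBL6` from oscillation bounds on a covering set of radii** (the plane-resolved twin of
`fbl_of_oscillation_cover`, one orientation `(0, 1)`). [folklore] -/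
theorem fbl6_of_oscillation_cover (a : ℝ → ℝ) (ha : ∀ β, 0 < a β) (S : Set ℕ) (θ : ℝ) (D : ℕ)
    (hcover : ∀ R : ℕ, D ≤ R → ∃ R₀ ∈ S, R₀ ≤ R ∧ (R : ℝ) + 1 ≤ θ * ((R₀ : ℝ) + 1))
    (h : ∃ (C₁ β₁ ℓ₁ : ℝ), 0 < ℓ₁ ∧ ∀ β : ℝ, β₁ ≤ β → ∀ R₀ ∈ S,
      ((2 * R₀ + 1 : ℕ) : ℝ) * a β ≤ ℓ₁ → ∀ η η' : LGConfig 4 G,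
        |kerE G r β (fun _ => -(R₀ : ℤ)) (2 * R₀ + 1) η (plane G r (0, 1) 0) -
          kerE G r β (fun _ => -(R₀ : ℤ)) (2 * R₀ + 1) η' (plane G r (0, 1) 0)| ≤ C₁ / ((R₀ : ℝ) + 1) ^ 4) :
    FBL6 G r a := by
  obtain ⟨C₁, β₁, ℓ₁, hℓ₁, H⟩ := h
  obtain ⟨M, hM⟩ := exists_abs_plane_le (G := G) r
  refine fbl6_of_oscillation G r a ha D ⟨θ ^ 4 * C₁, β₁, ℓ₁, hℓ₁, fun β hβ R hDR hRa η η' => ?_⟩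
  obtain ⟨R₀, hR₀S, hle, hθ⟩ := hcover R hDR
  exact osc_le_of_cover G r β (continuous_plane r (0, 1) 0) (hM (0, 1) 0) hle hθ
    (H β hβ R₀ hR₀S (admissible_of_le (ha β) hle hRa)) η η'

/-! ## §5 Geometric sequences of radii -/

/-- An unbounded sequence of radii with ratio-bounded gaps, `R (k+1) + 1 ≤ θ (R k + 1)`, covers every radius
`R' ≥ R 0` up to the factor `θ`. [folklore] -/
theorem cover_of_seq (Rs : ℕ → ℕ) (θ : ℝ) (hgap : ∀ k, (Rs (k + 1) : ℝ) + 1 ≤ θ * ((Rs k : ℝ) + 1))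
    (hunb : ∀ R : ℕ, ∃ k, R < Rs k) :
    ∀ R : ℕ, Rs 0 ≤ R → ∃ R₀ ∈ Set.range Rs, R₀ ≤ R ∧ (R : ℝ) + 1 ≤ θ * ((R₀ : ℝ) + 1) := by
  classical
  intro R hR
  let k₀ := Nat.find (hunb R)
  have hk₀ : R < Rs k₀ := Nat.find_spec (hunb R)
  have hk₀pos : 0 < k₀ := by
    by_contra h0
    have h00 : k₀ = 0 := by omega
    rw [h00] at hk₀
    omega
  obtain ⟨k, hk⟩ : ∃ k, k₀ = k + 1 := ⟨k₀ - 1, by omega⟩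
  have hkle : Rs k ≤ R := by
    have hmin := Nat.find_min (hunb R) (m := k) (by omega)
    exact not_lt.1 hmin
  refine ⟨Rs k, ⟨k, rfl⟩, hkle, ?_⟩
  have h1 : (R : ℝ) + 1 ≤ (Rs k₀ : ℝ) := by exact_mod_cast hk₀
  have h2 := hgap k
  rw [← hk] at h2
  linarith

/-- **`FBL` from oscillation bounds along a geometric sequence of radii.**  If the exterior-to-exterior oscillation of
the central kernel mean of the action density decays like `C₁/(R_k+1)⁴` along an unbounded sequence of radii with
`R_{k+1} + 1 ≤ θ (R_k + 1)` (e.g. the cube sizes of a multiscale expansion), then `FBL G r a` (constant `θ⁴ C₁`).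
[folklore] -/
theorem fbl_of_oscillation_seq (a : ℝ → ℝ) (ha : ∀ β, 0 < a β) (Rs : ℕ → ℕ) (θ : ℝ)
    (hgap : ∀ k, (Rs (k + 1) : ℝ) + 1 ≤ θ * ((Rs k : ℝ) + 1)) (hunb : ∀ R : ℕ, ∃ k, R < Rs k)
    (h : ∃ (C₁ β₁ ℓ₁ : ℝ), 0 < ℓ₁ ∧ ∀ β : ℝ, β₁ ≤ β → ∀ k : ℕ,
      ((2 * Rs k + 1 : ℕ) : ℝ) * a β ≤ ℓ₁ → ∀ η η' : LGConfig 4 G,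
        |kerE G r β (fun _ => -(Rs k : ℤ)) (2 * Rs k + 1) η (dens G r 0) -
          kerE G r β (fun _ => -(Rs k : ℤ)) (2 * Rs k + 1) η' (dens G r 0)| ≤ C₁ / ((Rs k : ℝ) + 1) ^ 4) :
    FBL G r a := by
  obtain ⟨C₁, β₁, ℓ₁, hℓ₁, H⟩ := h
  refine fbl_of_oscillation_cover G r a ha (Set.range Rs) θ (Rs 0) (cover_of_seq Rs θ hgap hunb)
    ⟨C₁, β₁, ℓ₁, hℓ₁, fun β hβ R₀ hR₀ hadm η η' => ?_⟩
  obtain ⟨k, rfl⟩ := hR₀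
  exact H β hβ k hadm η η'

/-- **`FBL6` from oscillation bounds along a geometric sequence of radii** (one orientation `(0, 1)`). [folklore] -/
theorem fbl6_of_oscillation_seq (a : ℝ → ℝ) (ha : ∀ β, 0 < a β) (Rs : ℕ → ℕ) (θ : ℝ)
    (hgap : ∀ k, (Rs (k + 1) : ℝ) + 1 ≤ θ * ((Rs k : ℝ) + 1)) (hunb : ∀ R : ℕ, ∃ k, R < Rs k)
    (h : ∃ (C₁ β₁ ℓ₁ : ℝ), 0 < ℓ₁ ∧ ∀ β : ℝ, β₁ ≤ β → ∀ k : ℕ,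
      ((2 * Rs k + 1 : ℕ) : ℝ) * a β ≤ ℓ₁ → ∀ η η' : LGConfig 4 G,
        |kerE G r β (fun _ => -(Rs k : ℤ)) (2 * Rs k + 1) η (plane G r (0, 1) 0) -
          kerE G r β (fun _ => -(Rs k : ℤ)) (2 * Rs k + 1) η' (plane G r (0, 1) 0)| ≤ C₁ / ((Rs k : ℝ) + 1) ^ 4) :
    FBL6 G r a := by
  obtain ⟨C₁, β₁, ℓ₁, hℓ₁, H⟩ := h
  refine fbl6_of_oscillation_cover G r a ha (Set.range Rs) θ (Rs 0) (cover_of_seq Rs θ hgap hunb)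
    ⟨C₁, β₁, ℓ₁, hℓ₁, fun β hβ R₀ hR₀ hadm η η' => ?_⟩
  obtain ⟨k, rfl⟩ := hR₀
  exact H β hβ k hadm η η'

end Kernel

end Summit.QuantumFields.YangMills.Cruxes.NT.BoundaryLaw

end
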